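import Literature.Geometry.Kaehler.ComplexTorusTranscendentalEndomorphismDeterminant
import Literature.Geometry.Kaehler.ComplexTorusTranscendentalHodgeGroupCommutativeIff
import Literature.Geometry.Kaehler.ComplexTorusEllipticCurveEndomorphismRing
import Literature.Geometry.Kaehler.ComplexTorusHodgeClassesEllipticPair
import Literature.Geometry.Kaehler.ComplexTorusLefschetzGroupFiniteProduct
import Literature.Geometry.Kaehler.ComplexTorusPicardPoincareProperties
import HarnessLib

/-!
# The transcendental part of a product of two elliptic curves: complex multiplication of a factor gives complex multiplication on
# `T(E₁ × E₂)_ℚ` — `End(E₁) ⊂ K_T` along `ε` —, and two non-isogenous CM factors make `Hdg(T)(ℚ)` commutative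
# (Elsenhans–Jahnel 2014, Rem. 3.5 (i); Huybrechts, *Lectures on K3 Surfaces*, Ch. 3 Cor. 3.6, Rem. 3.10)

[topic Geometry/Kaehler]

Layer `Literature/Geometry/Kaehler`, namespace `Literature.Geometry.Kaehler.ComplexTorus`; lane `lit-hodgefound` (Track 2 foundations
library), prover seat `lit-hodgefound-p08`, generation 32, self-proposed row g32-#2 of `run/shared/lean/pub/lit-hodgefound/SKELETON.md`
(ONE file). Sequel of g32-#1 `ComplexTorusTranscendentalEndomorphismDeterminant` (a holomorphic endomorphism `f` of a complex abelian surface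
acts on `T(X)_ℚ` through `a_f ∈ K_T` with `ε(a_f) = det ρ_a(f)`; `det ρ_a(f) ∉ ℝ ⟹ K_T` is a CM field), INSTANTIATED on the product
`X = E_τ × E_τ'` of two elliptic curves `E_τ = ℂ/(ℤτ + ℤ)` (the tree's `prodPeriod (ellipticPeriod hτ) (ellipticPeriod hτ')`), with the
endomorphisms `α × α'`, `α ∈ End(E_τ) = ℛ_τ = {α ∈ ℂ : α(ℤτ + ℤ) ⊆ ℤτ + ℤ}` (`ellipticEnd hτ`, Silverman VI Thm. 5.5), whose analytic
representation is `diag(α, α')` and whose determinant is `αα'`. THEOREMS ONLY: no definition, no named fact (net Literature debt `0`).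

## Sources, verbatim

* A.-S. Elsenhans, J. Jahnel, *Examples of K3 surfaces with real multiplication*, LMS J. Comput. Math. 17 A (2014) [ElsenhansJahnel2014],
  held text `paper:arxiv-1402.4555`, p0006: "**Remarks 3.5.** i) The Kummer surface `Kum(E₁ × E₂)` attached to the product of two elliptic
  curves `E₁` and `E₂` has complex multiplication if one of the elliptic curves has." (Def. 2.7, p0005: "If `End(T)` is a CM field then
  `T` has complex multiplication"; p0003: "In the case of an elliptic curve or abelian surface, the endomorphism field `End(X) ⊗_ℤ ℚ` is
  canonically isomorphic to the endomorphism field `End(H)` of the associated Hodge structure `H := H¹(X, ℚ)`".) `T(Kum A)_ℚ ≅ T(A)_ℚ`;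
  this file proves the statement for `T(E₁ × E₂)_ℚ` itself.
* D. Huybrechts, *Lectures on K3 Surfaces* (CUP 2016) [Huybrechts2016K3], Ch. 3 p0065 Cor. 3.6 ("`ε : K = End_Hdg(T) → ℂ` defined by
  `a|_{T^{2,0}} = ε(a) · id` […] is injective and `K` is a number field"), p0067 Rem. 3.10 ("`Hdg(T)` is commutative. This turns out to
  be equivalent to `dim_K T = 1`"), p0069 (3.2) `dim_ℚ T = dim_K T · [K : ℚ]`.
* J. H. Silverman, *The Arithmetic of Elliptic Curves* (GTM 106) [SilvermanAEC2009], Ch. VI Thm. 5.5 (`End(E) ≅ {α ∈ ℂ : αΛ ⊂ Λ}`, `= ℤ`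
  or an order in the imaginary quadratic field `ℚ(τ)`); H. Lange, *Abelian Varieties over the Complex Numbers* (2023)
  [Lange2023AbelianVarietiesComplex], §1.1.2 Prop. 1.1.6 (analytic / rational representation), §2.6 Exercise (3) (Picard numbers of
  `E_τ × E_τ'`: `ρ = 2` iff `1, τ, τ', ττ'` are `ℚ`-linearly independent — the non-isogenous case).

## What is proved (`X = E_τ × E_τ'`, `Im τ, Im τ' ≠ 0`, lattice index `Fin 2 ⊕ Fin 2` enumerated by `finSumFinEquiv` in the proofs, `T` the
transcendental part of `H²(X, ℚ)`, `K_T = End_Hdg(T(X)_ℚ)`, `ε : K_T →ₐ[ℚ] ℂ` any map through which `K_T` acts on `T^{2,0}`)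

* §1 `isAbelianVariety_ellipticProd` (`E_τ × E_τ'` is an abelian surface), `prodPeriod_fromBlocks_mulVec_of_eq_mul` (the analytic representation of
  `α × α' = ρ(diag(A, A'))` is `diag(α, α')` — the tree's `prodPeriod_fromBlocks_mulVec` of `ComplexTorusPicardPoincareProperties`, REUSED),
  `det_smul_id_prodMap_smul_id` (`det diag(α, α') = αα'`).
* §2 `exists_endAlg_transcendentalPart_coe_eq_pullbackForms_fromBlocks` (an `a ∈ K_T` restricting `(α × α')^*`) and
  **`eps_eq_mul_of_coe_eq_pullbackForms_fromBlocks`** (`ε(a) = αα'`); **`mem_range_eps_of_mem_ellipticEnd_left/right`** (`ℛ_τ ⊆ ε(K_T)` and `ℛ_τ' ⊆ ε(K_T)`: the endomorphism rings of the factors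
  sit in `K_T`), `mul_mem_range_algHom`, `mul_mem_range_eps` (`ℛ_τ · ℛ_τ' ⊆ ε(K_T)`), `mem_range_eps_iff`, `mem_of_natCast_mul_mem`,
  **`mem_range_eps_of_quadratic_left/right`** (`τ ∈ ε(K_T)` when `E_τ` has complex multiplication, i.e. `ℚ(τ) ⊆ ε(K_T)`).
* §3 (Rem. 3.5 (i)) `exists_det_im_ne_zero_of_quadratic_left/right` (`α × 1` has non-real `det ρ_a = α`),
  **`isCMField_endAlg_transcendentalPart_of_quadratic_left`** / `…_right` — if `E_τ` (or `E_τ'`) has complex multiplication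
  (`τ² + pτ + q = 0` over `ℚ`) then `K_T` is a CM field —, `exists_isCMField_algEquiv_of_quadratic_left`,
  `finrank_hodgeClasses_eq_two_or_eq_four_of_quadratic_left` (`ρ(X) ∈ {2, 4}`), `endAlg_transcendentalPart_ne_bot_of_quadratic_left`.
* §4 (generic: `four_le_finrank_of_linearIndependent`, `range_eq_span_pair_of_finrank_eq_two` for a `ℚ`-algebra map `K → ℂ`); (two CM factors,
  NOT isogenous: `1, τ, τ', ττ'` linearly independent over `ℚ`) `four_le_finrank_endAlg_transcendentalPart_of_quadratic_of_linearIndependent`,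
  **`finrank_endAlg_transcendentalPart_eq_four`**
  (`[K_T : ℚ] = 4 = dim_ℚ T(X)_ℚ`, i.e. `dim_{K_T} T = 1`) and **`hodgeGroup_transcendentalPart_comm_of_quadratic_of_linearIndependent`**
  (Rem. 3.10: `Hdg(T(X)_ℚ)(ℚ)` is commutative); (two CM factors, `ρ(X) = 4`) **`range_eps_eq_span_of_eq_four`** (`ε(K_T) = ℚ + ℚτ = ℚ(τ)`:
  the endomorphism field of `T` is the common CM field of the factors).

NOT here: `End(E_τ) ⊗ ℚ ≅ K_T` when only one factor has CM (the inclusion `ℚ(τ) ⊆ ε(K_T)` is proved, equality would need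
`Hdg(T(X)_ℚ)(ℚ)` non-commutative); Kummer surfaces.

## References

* [ElsenhansJahnel2014] A.-S. Elsenhans, J. Jahnel, *Examples of K3 surfaces with real multiplication*, LMS J. Comput. Math. 17 A (2014)
  14–35, §1 (p. 3), Def. 2.7, Rem. 3.5 (i).
* [Huybrechts2016K3] D. Huybrechts, *Lectures on K3 Surfaces*, CUP (2016), Ch. 3 Cor. 3.6, Rem. 3.10, eq. (3.2), Rem. 3.14.
* [SilvermanAEC2009] J. H. Silverman, *The Arithmetic of Elliptic Curves*, 2nd ed., Springer (2009), Ch. VI Thm. 5.5.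
* [Lange2023AbelianVarietiesComplex] H. Lange, *Abelian Varieties over the Complex Numbers*, Springer (2023), §1.1.2 Prop. 1.1.6, Cor. 2.4.24,
  §2.6 Exercises (2)–(3).
-/

noncomputable section

open scoped Classical TensorProduct

set_option maxSynthPendingDepth 5
set_option synthInstance.maxHeartbeats 200000

open Function Module Complex Literature.AlgebraicGeometry.Motives Literature.AlgebraicGeometry.Motives.HodgeStructure
  Literature.Geometry.Kaehler

namespace Literature.Geometry.Kaehler

namespace ComplexTorus

/-! ## §1 The abelian surface `E_τ × E_τ'` and the endomorphisms `α × α'` -/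

section Product

variable {τ τ' : ℂ} (hτ : τ.im ≠ 0) (hτ' : τ'.im ≠ 0)

/-- **`E_τ × E_τ'` is an abelian surface** (a product of abelian varieties). [cite: Lange2023AbelianVarietiesComplex, Cor. 2.4.24 and §2.1.1 Example 2.1.3] -/
theorem isAbelianVariety_ellipticProd : IsAbelianVariety (prodPeriod (ellipticPeriod hτ) (ellipticPeriod hτ')) :=
  (isAbelianVariety_ellipticPeriod hτ).prod (isAbelianVariety_ellipticPeriod hτ')

end Product



section Elliptic

variable {τ τ' : ℂ} (hτ : τ.im ≠ 0) (hτ' : τ'.im ≠ 0)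

/-- **`diag(α, α')` is the analytic representation of `α × α'` on `E_τ × E_τ'`** for `α ∈ ℛ_τ`, `α' ∈ ℛ_τ'` given by the integer matrices
`A`, `A'` (`Φ_τ ∘ A_ℝ = α · Φ_τ`). [cite: Lange2023AbelianVarietiesComplex, §1.1.2 Prop. 1.1.6] [cite: SilvermanAEC2009, Ch. VI Thm. 5.5] -/
theorem prodPeriod_fromBlocks_mulVec_of_eq_mul {A A' : Matrix (Fin 2) (Fin 2) ℤ} {α α' : ℂ}
    (hA : ∀ x, ellipticPeriod hτ ((A.map (Int.cast : ℤ → ℝ)).mulVec x) = α * ellipticPeriod hτ x)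
    (hA' : ∀ x, ellipticPeriod hτ' ((A'.map (Int.cast : ℤ → ℝ)).mulVec x) = α' * ellipticPeriod hτ' x) (x : Fin 2 ⊕ Fin 2 → ℝ) :
    prodPeriod (ellipticPeriod hτ) (ellipticPeriod hτ') (((Matrix.fromBlocks A 0 0 A').map (Int.cast : ℤ → ℝ)).mulVec x) =
      ((α • ContinuousLinearMap.id ℂ ℂ).prodMap (α' • ContinuousLinearMap.id ℂ ℂ)) (prodPeriod (ellipticPeriod hτ) (ellipticPeriod hτ') x) :=
  prodPeriod_fromBlocks_mulVec (ellipticPeriod hτ) (ellipticPeriod hτ') (ellipticPeriod hτ) (ellipticPeriod hτ')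
    (F := α • ContinuousLinearMap.id ℂ ℂ) (G := α' • ContinuousLinearMap.id ℂ ℂ)
    (fun y => by rw [hA y, smul_apply, ContinuousLinearMap.id_apply, smul_eq_mul])
    (fun y => by rw [hA' y, smul_apply, ContinuousLinearMap.id_apply, smul_eq_mul]) x

/-- **`det diag(α, α') = αα'`.** [cite: Lange2023AbelianVarietiesComplex, §2.4.1 (analytic norm)] -/
theorem det_smul_id_prodMap_smul_id (α α' : ℂ) :
    LinearMap.det (((α • ContinuousLinearMap.id ℂ ℂ).prodMap (α' • ContinuousLinearMap.id ℂ ℂ) : ℂ × ℂ →L[ℂ] ℂ × ℂ) : ℂ × ℂ →ₗ[ℂ] ℂ × ℂ) =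
      α * α' := by
  rw [ContinuousLinearMap.coe_prodMap, LinearMap.det_prodMap, ContinuousLinearMap.toLinearMap_smul, ContinuousLinearMap.toLinearMap_smul,
    ContinuousLinearMap.coe_id, LinearMap.det_smul, LinearMap.det_smul, LinearMap.det_id, Module.finrank_self, pow_one, pow_one, mul_one,
    mul_one]

/-! ## §2 `ℛ_τ, ℛ_τ' ⊂ ε(K_T)`: the endomorphisms of the factors act on `T(E_τ × E_τ')_ℚ` through `K_T` with `ε(a_{α × α'}) = αα'` -/

variable {T : SubHodgeStructure (hodgeStructure (prodPeriod (ellipticPeriod hτ) (ellipticPeriod hτ')) 2)}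

/-- **`α × α'` acts on `T(E_τ × E_τ')_ℚ` through some `a ∈ K_T`** (g31-#3 for the abelian surface `E_τ × E_τ'` and the matrix `diag(A, A')`).
[cite: Huybrechts2016K3, Ch. 15 Rem. 1.2] [cite: Lange2023AbelianVarietiesComplex, §1.1.2 Prop. 1.1.6] -/
theorem exists_endAlg_transcendentalPart_coe_eq_pullbackForms_fromBlocks
    (hT : (hodgeStructure (prodPeriod (ellipticPeriod hτ) (ellipticPeriod hτ')) 2).IsTranscendentalPart T)
    {A A' : Matrix (Fin 2) (Fin 2) ℤ} {α α' : ℂ} (hA : ∀ x, ellipticPeriod hτ ((A.map (Int.cast : ℤ → ℝ)).mulVec x) = α * ellipticPeriod hτ x)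
    (hA' : ∀ x, ellipticPeriod hτ' ((A'.map (Int.cast : ℤ → ℝ)).mulVec x) = α' * ellipticPeriod hτ' x) :
    ∃ a : T.toHodgeStructure.endAlg, ∀ x : T.toSubmodule,
      (((a : Module.End ℚ T.toSubmodule) x : T.toSubmodule) : rationalForms (prodPeriod (ellipticPeriod hτ) (ellipticPeriod hτ')) 2) =
        pullbackForms (prodPeriod (ellipticPeriod hτ) (ellipticPeriod hτ')) (prodPeriod (ellipticPeriod hτ) (ellipticPeriod hτ'))
          (Matrix.fromBlocks A 0 0 A') 2 (x : rationalForms (prodPeriod (ellipticPeriod hτ) (ellipticPeriod hτ')) 2) :=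
  (isAbelianVariety_ellipticProd hτ hτ').exists_endAlg_transcendentalPart_coe_eq_pullbackForms (finSumFinEquiv (m := 2) (n := 2)).symm hT
    ⟨(α • ContinuousLinearMap.id ℂ ℂ).prodMap (α' • ContinuousLinearMap.id ℂ ℂ), prodPeriod_fromBlocks_mulVec_of_eq_mul hτ hτ' hA hA'⟩

/-- **`ε(a) = αα'` for the element `a ∈ K_T` through which `α × α'` acts on `T(X)_ℚ`** (`ε(a) = det ρ_a(α × α') = det diag(α, α')`, g31-#4).
[cite: ElsenhansJahnel2014, Rem. 3.5 (i) and §1 (p. 3)] [cite: Huybrechts2016K3, Ch. 3 Cor. 3.6 and Ch. 15 Rem. 1.2] -/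
theorem eps_eq_mul_of_coe_eq_pullbackForms_fromBlocks
    (hT : (hodgeStructure (prodPeriod (ellipticPeriod hτ) (ellipticPeriod hτ')) 2).IsTranscendentalPart T)
    {A A' : Matrix (Fin 2) (Fin 2) ℤ} {α α' : ℂ} (hA : ∀ x, ellipticPeriod hτ ((A.map (Int.cast : ℤ → ℝ)).mulVec x) = α * ellipticPeriod hτ x)
    (hA' : ∀ x, ellipticPeriod hτ' ((A'.map (Int.cast : ℤ → ℝ)).mulVec x) = α' * ellipticPeriod hτ' x) {a : T.toHodgeStructure.endAlg}
    (ha : ∀ x : T.toSubmodule,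
      (((a : Module.End ℚ T.toSubmodule) x : T.toSubmodule) : rationalForms (prodPeriod (ellipticPeriod hτ) (ellipticPeriod hτ')) 2) =
        pullbackForms (prodPeriod (ellipticPeriod hτ) (ellipticPeriod hτ')) (prodPeriod (ellipticPeriod hτ) (ellipticPeriod hτ'))
          (Matrix.fromBlocks A 0 0 A') 2 (x : rationalForms (prodPeriod (ellipticPeriod hτ) (ellipticPeriod hτ')) 2))
    {ε : T.toHodgeStructure.endAlg →ₐ[ℚ] ℂ}
    (hε : ∀ (b : T.toHodgeStructure.endAlg) (z : ℂ ⊗[ℚ] T.toSubmodule), z ∈ T.toHodgeStructure.piece 2 0 →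
      (b : Module.End ℚ T.toSubmodule).baseChange ℂ z = ε b • z) :
    ε a = α * α' :=
  ((isAbelianVariety_ellipticProd hτ hτ').eps_eq_det_of_coe_eq_pullbackForms (finSumFinEquiv (m := 2) (n := 2)).symm hT
    (prodPeriod_fromBlocks_mulVec_of_eq_mul hτ hτ' hA hA') ha hε).trans (det_smul_id_prodMap_smul_id α α')

/-- Products of elements of the image of a `ℚ`-algebra map `K → ℂ` lie in the image. [cite: Huybrechts2016K3, Ch. 3 Cor. 3.6] -/
theorem mul_mem_range_algHom {K : Type*} [Ring K] [Algebra ℚ K] (ε : K →ₐ[ℚ] ℂ) {a b : ℂ} (ha : a ∈ Set.range ε)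
    (hb : b ∈ Set.range ε) : a * b ∈ Set.range ε :=
  ha.elim fun x hx => hb.elim fun y hy => ⟨x * y, by rw [map_mul, hx, hy]⟩

/-- **For `α ∈ End(E_τ)`, `α' ∈ End(E_τ')` the product `αα'` lies in `ε(K_T)`**: `αα' = ε(a_{α × α'})`. (Term-mode proof: in this concrete
setting `obtain` on the matrix existentials exhausts the heartbeat budget, `Exists.elim` does not.)
[cite: ElsenhansJahnel2014, Rem. 3.5 (i) and §1 (p. 3)] [cite: Huybrechts2016K3, Ch. 3 Cor. 3.6 and Ch. 15 Rem. 1.2] -/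
theorem mul_mem_range_eps (hT : (hodgeStructure (prodPeriod (ellipticPeriod hτ) (ellipticPeriod hτ')) 2).IsTranscendentalPart T)
    {ε : T.toHodgeStructure.endAlg →ₐ[ℚ] ℂ}
    (hε : ∀ (b : T.toHodgeStructure.endAlg) (z : ℂ ⊗[ℚ] T.toSubmodule), z ∈ T.toHodgeStructure.piece 2 0 →
      (b : Module.End ℚ T.toSubmodule).baseChange ℂ z = ε b • z) {α α' : ℂ} (hα : α ∈ ellipticEnd hτ) (hα' : α' ∈ ellipticEnd hτ') :
    α * α' ∈ Set.range ε :=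
  ((mem_ellipticEnd_iff_exists_matrix hτ).1 hα).elim fun _ hA =>
    ((mem_ellipticEnd_iff_exists_matrix hτ').1 hα').elim fun _ hA' =>
      (exists_endAlg_transcendentalPart_coe_eq_pullbackForms_fromBlocks hτ hτ' hT hA hA').elim fun a ha =>
        Set.mem_range.2 ⟨a, eps_eq_mul_of_coe_eq_pullbackForms_fromBlocks hτ hτ' hT hA hA' ha hε⟩

/-- **`ℛ_τ ⊆ ε(K_T)`: the endomorphism ring of the first factor lies in the image of `K_T ↪ ℂ`** (`α = ε(a_{α × 1})`).
[cite: ElsenhansJahnel2014, Rem. 3.5 (i) and §1 (p. 3)] [cite: Huybrechts2016K3, Ch. 3 Cor. 3.6] -/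
theorem mem_range_eps_of_mem_ellipticEnd_left
    (hT : (hodgeStructure (prodPeriod (ellipticPeriod hτ) (ellipticPeriod hτ')) 2).IsTranscendentalPart T)
    {ε : T.toHodgeStructure.endAlg →ₐ[ℚ] ℂ}
    (hε : ∀ (b : T.toHodgeStructure.endAlg) (z : ℂ ⊗[ℚ] T.toSubmodule), z ∈ T.toHodgeStructure.piece 2 0 →
      (b : Module.End ℚ T.toSubmodule).baseChange ℂ z = ε b • z) {α : ℂ} (hα : α ∈ ellipticEnd hτ) :
    α ∈ Set.range ε :=
  mul_one α ▸ mul_mem_range_eps hτ hτ' hT hε hα (Subring.one_mem (ellipticEnd hτ'))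

/-- **`ℛ_τ' ⊆ ε(K_T)`** (the second factor). [cite: ElsenhansJahnel2014, Rem. 3.5 (i) and §1 (p. 3)] [cite: Huybrechts2016K3, Ch. 3 Cor. 3.6] -/
theorem mem_range_eps_of_mem_ellipticEnd_right
    (hT : (hodgeStructure (prodPeriod (ellipticPeriod hτ) (ellipticPeriod hτ')) 2).IsTranscendentalPart T)
    {ε : T.toHodgeStructure.endAlg →ₐ[ℚ] ℂ}
    (hε : ∀ (b : T.toHodgeStructure.endAlg) (z : ℂ ⊗[ℚ] T.toSubmodule), z ∈ T.toHodgeStructure.piece 2 0 →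
      (b : Module.End ℚ T.toSubmodule).baseChange ℂ z = ε b • z) {α' : ℂ} (hα' : α' ∈ ellipticEnd hτ') :
    α' ∈ Set.range ε :=
  one_mul α' ▸ mul_mem_range_eps hτ hτ' hT hε (Subring.one_mem (ellipticEnd hτ)) hα'

/-- `ε(K_T)` is a `ℚ`-subspace of `ℂ` (the range of the `ℚ`-linear map underlying `ε`); membership transfer. [cite: Huybrechts2016K3, Ch. 3 Cor. 3.6] -/
theorem mem_range_eps_iff {V : Type*} [AddCommGroup V] [Module ℚ V] {H : HodgeStructure V 2} (ε : H.endAlg →ₐ[ℚ] ℂ) (z : ℂ) :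
    z ∈ Set.range ε ↔ z ∈ LinearMap.range ε.toLinearMap := by
  simp [LinearMap.mem_range]

/-- A `ℚ`-subspace of `ℂ` containing `c · z` (`c ≠ 0` a natural number) contains `z`. [cite: SilvermanAEC2009, Ch. VI Thm. 5.5 (proof: "ℛ ⊂ ℚ(τ)")] -/
theorem mem_of_natCast_mul_mem {W : Submodule ℚ ℂ} {c : ℕ} (hc : c ≠ 0) {z : ℂ} (h : (c : ℂ) * z ∈ W) : z ∈ W := by
  have h' : ((c : ℚ)⁻¹) • ((c : ℂ) * z) ∈ W := W.smul_mem _ h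
  have hc' : (c : ℂ) ≠ 0 := by exact_mod_cast hc
  have key : ((c : ℚ)⁻¹) • ((c : ℂ) * z) = z := by
    rw [Rat.smul_def, Rat.cast_inv, Rat.cast_natCast, ← mul_assoc, inv_mul_cancel₀ hc', one_mul]
  rwa [key] at h'

/-- **`E_τ` with complex multiplication ⟹ `τ ∈ ε(K_T)`, i.e. `ℚ(τ) = ℚ + ℚτ ⊆ ε(K_T)`** (`ℛ_τ = ℤ + ℤ·cτ` with `c > 0`, and `ε(K_T)` is a
`ℚ`-subspace). [cite: ElsenhansJahnel2014, Rem. 3.5 (i)] [cite: SilvermanAEC2009, Ch. VI Thm. 5.5] -/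
theorem mem_range_eps_of_quadratic_left
    (hT : (hodgeStructure (prodPeriod (ellipticPeriod hτ) (ellipticPeriod hτ')) 2).IsTranscendentalPart T)
    {ε : T.toHodgeStructure.endAlg →ₐ[ℚ] ℂ}
    (hε : ∀ (b : T.toHodgeStructure.endAlg) (z : ℂ ⊗[ℚ] T.toSubmodule), z ∈ T.toHodgeStructure.piece 2 0 →
      (b : Module.End ℚ T.toSubmodule).baseChange ℂ z = ε b • z) {p q : ℚ} (hquad : τ ^ 2 + p * τ + q = 0) :
    τ ∈ Set.range ε :=
  (exists_generator_ellipticEnd hτ).elim fun c hc =>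
    have hc0 : 0 < c := hc.2.2 ⟨p, q, hquad⟩
    have hmem : ((c : ℂ) * τ) ∈ ellipticEnd hτ := (hc.1 _).2 ⟨0, 1, by push_cast; ring⟩
    (mem_range_eps_iff ε τ).2 (mem_of_natCast_mul_mem hc0.ne'
      ((mem_range_eps_iff ε _).1 (mem_range_eps_of_mem_ellipticEnd_left hτ hτ' hT hε hmem)))

/-- **`E_τ'` with complex multiplication ⟹ `τ' ∈ ε(K_T)`.** [cite: ElsenhansJahnel2014, Rem. 3.5 (i)] [cite: SilvermanAEC2009, Ch. VI Thm. 5.5] -/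
theorem mem_range_eps_of_quadratic_right
    (hT : (hodgeStructure (prodPeriod (ellipticPeriod hτ) (ellipticPeriod hτ')) 2).IsTranscendentalPart T)
    {ε : T.toHodgeStructure.endAlg →ₐ[ℚ] ℂ}
    (hε : ∀ (b : T.toHodgeStructure.endAlg) (z : ℂ ⊗[ℚ] T.toSubmodule), z ∈ T.toHodgeStructure.piece 2 0 →
      (b : Module.End ℚ T.toSubmodule).baseChange ℂ z = ε b • z) {p q : ℚ} (hquad : τ' ^ 2 + p * τ' + q = 0) :
    τ' ∈ Set.range ε :=
  (exists_generator_ellipticEnd hτ').elim fun c hc =>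
    have hc0 : 0 < c := hc.2.2 ⟨p, q, hquad⟩
    have hmem : ((c : ℂ) * τ') ∈ ellipticEnd hτ' := (hc.1 _).2 ⟨0, 1, by push_cast; ring⟩
    (mem_range_eps_iff ε τ').2 (mem_of_natCast_mul_mem hc0.ne'
      ((mem_range_eps_iff ε _).1 (mem_range_eps_of_mem_ellipticEnd_right hτ hτ' hT hε hmem)))

/-! ## §3 Rem. 3.5 (i): complex multiplication of one factor makes `K_T` a CM field -/

/-- **A factor with complex multiplication yields an endomorphism `α × 1` of `E_τ × E_τ'` with NON-REAL `det ρ_a = α`** (`α = a + bτ ∈ ℛ_τ`,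
`b ≠ 0`). [cite: ElsenhansJahnel2014, Rem. 3.5 (i)] [cite: SilvermanAEC2009, Ch. VI Thm. 5.5] -/
theorem exists_det_im_ne_zero_of_quadratic_left {p q : ℚ} (hquad : τ ^ 2 + p * τ + q = 0) :
    ∃ (B : Matrix (Fin 2 ⊕ Fin 2) (Fin 2 ⊕ Fin 2) ℤ) (F : ℂ × ℂ →L[ℂ] ℂ × ℂ),
      (∀ x, prodPeriod (ellipticPeriod hτ) (ellipticPeriod hτ') ((B.map (Int.cast : ℤ → ℝ)).mulVec x) =
        F (prodPeriod (ellipticPeriod hτ) (ellipticPeriod hτ') x)) ∧ (LinearMap.det (F : ℂ × ℂ →ₗ[ℂ] ℂ × ℂ)).im ≠ 0 := by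
  obtain ⟨α, hα, hαZ⟩ := exists_mem_not_mem_bot_of_quadratic hτ hquad
  obtain ⟨a, b, hab⟩ := exists_int_eq_of_mem hτ hα
  have hb : b ≠ 0 := fun hb => hαZ (by rw [hab]; exact (intCast_add_mul_mem_bot_iff hτ).2 hb)
  obtain ⟨A, hA⟩ := (mem_ellipticEnd_iff_exists_matrix hτ).1 hα
  obtain ⟨A', hA'⟩ := (mem_ellipticEnd_iff_exists_matrix hτ').1 (Subring.one_mem (ellipticEnd hτ'))
  refine ⟨Matrix.fromBlocks A 0 0 A', _, prodPeriod_fromBlocks_mulVec_of_eq_mul hτ hτ' hA hA', ?_⟩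
  rw [det_smul_id_prodMap_smul_id, mul_one, hab]
  have him : ((a : ℂ) + b * τ).im = b * τ.im := by simp
  rw [him]
  exact mul_ne_zero (Int.cast_ne_zero.2 hb) hτ

/-- The same with the second factor: `1 × α'`. [cite: ElsenhansJahnel2014, Rem. 3.5 (i)] [cite: SilvermanAEC2009, Ch. VI Thm. 5.5] -/
theorem exists_det_im_ne_zero_of_quadratic_right {p q : ℚ} (hquad : τ' ^ 2 + p * τ' + q = 0) :
    ∃ (B : Matrix (Fin 2 ⊕ Fin 2) (Fin 2 ⊕ Fin 2) ℤ) (F : ℂ × ℂ →L[ℂ] ℂ × ℂ),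
      (∀ x, prodPeriod (ellipticPeriod hτ) (ellipticPeriod hτ') ((B.map (Int.cast : ℤ → ℝ)).mulVec x) =
        F (prodPeriod (ellipticPeriod hτ) (ellipticPeriod hτ') x)) ∧ (LinearMap.det (F : ℂ × ℂ →ₗ[ℂ] ℂ × ℂ)).im ≠ 0 := by
  obtain ⟨α', hα', hαZ⟩ := exists_mem_not_mem_bot_of_quadratic hτ' hquad
  obtain ⟨a, b, hab⟩ := exists_int_eq_of_mem hτ' hα'
  have hb : b ≠ 0 := fun hb => hαZ (by rw [hab]; exact (intCast_add_mul_mem_bot_iff hτ').2 hb)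
  obtain ⟨A, hA⟩ := (mem_ellipticEnd_iff_exists_matrix hτ).1 (Subring.one_mem (ellipticEnd hτ))
  obtain ⟨A', hA'⟩ := (mem_ellipticEnd_iff_exists_matrix hτ').1 hα'
  refine ⟨Matrix.fromBlocks A 0 0 A', _, prodPeriod_fromBlocks_mulVec_of_eq_mul hτ hτ' hA hA', ?_⟩
  rw [det_smul_id_prodMap_smul_id, one_mul, hab]
  have him : ((a : ℂ) + b * τ').im = b * τ'.im := by simp
  rw [him]
  exact mul_ne_zero (Int.cast_ne_zero.2 hb) hτ'

/-- **Rem. 3.5 (i) for `T(E_τ × E_τ')_ℚ`: if `E_τ` has complex multiplication (`τ` imaginary quadratic: `τ² + pτ + q = 0` over `ℚ`), then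
`K_T = End_Hdg(T(E_τ × E_τ')_ℚ)` is a CM field.** [cite: ElsenhansJahnel2014, Rem. 3.5 (i) and Def. 2.7] [cite: Huybrechts2016K3, Ch. 3 Thm. 3.7 and Cor. 3.6] -/
theorem isCMField_endAlg_transcendentalPart_of_quadratic_left
    (hT : (hodgeStructure (prodPeriod (ellipticPeriod hτ) (ellipticPeriod hτ')) 2).IsTranscendentalPart T) {p q : ℚ}
    (hquad : τ ^ 2 + p * τ + q = 0) {K : Type*} [Field K] [NumberField K] (f : K ≃ₐ[ℚ] T.toHodgeStructure.endAlg) :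
    NumberField.IsCMField K := by
  obtain ⟨B, F, hF, him⟩ := exists_det_im_ne_zero_of_quadratic_left hτ hτ' hquad
  exact (isAbelianVariety_ellipticProd hτ hτ').isCMField_of_det_im_ne_zero (finSumFinEquiv (m := 2) (n := 2)).symm hT hF him f

/-- **Rem. 3.5 (i), second factor: if `E_τ'` has complex multiplication then `K_T` is a CM field.** [cite: ElsenhansJahnel2014, Rem. 3.5 (i) and Def. 2.7]
[cite: Huybrechts2016K3, Ch. 3 Thm. 3.7 and Cor. 3.6] -/
theorem isCMField_endAlg_transcendentalPart_of_quadratic_right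
    (hT : (hodgeStructure (prodPeriod (ellipticPeriod hτ) (ellipticPeriod hτ')) 2).IsTranscendentalPart T) {p q : ℚ}
    (hquad : τ' ^ 2 + p * τ' + q = 0) {K : Type*} [Field K] [NumberField K] (f : K ≃ₐ[ℚ] T.toHodgeStructure.endAlg) :
    NumberField.IsCMField K := by
  obtain ⟨B, F, hF, him⟩ := exists_det_im_ne_zero_of_quadratic_right hτ hτ' hquad
  exact (isAbelianVariety_ellipticProd hτ hτ').isCMField_of_det_im_ne_zero (finSumFinEquiv (m := 2) (n := 2)).symm hT hF him f

/-- … with the number field packaged: **there is a CM number field `K ≃ K_T`.** [cite: ElsenhansJahnel2014, Rem. 3.5 (i)]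
[cite: Huybrechts2016K3, Ch. 3 Cor. 3.6 and Thm. 3.7] -/
theorem exists_isCMField_algEquiv_of_quadratic_left
    (hT : (hodgeStructure (prodPeriod (ellipticPeriod hτ) (ellipticPeriod hτ')) 2).IsTranscendentalPart T) {p q : ℚ}
    (hquad : τ ^ 2 + p * τ + q = 0) :
    ∃ (K : Type) (_ : Field K) (_ : NumberField K), NumberField.IsCMField K ∧ Nonempty (K ≃ₐ[ℚ] T.toHodgeStructure.endAlg) := by
  obtain ⟨B, F, hF, him⟩ := exists_det_im_ne_zero_of_quadratic_left hτ hτ' hquad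
  exact (isAbelianVariety_ellipticProd hτ hτ').exists_isCMField_algEquiv_of_forall_det_ne (finSumFinEquiv (m := 2) (n := 2)).symm hT hF
    (forall_ne_ratCast_of_im_ne_zero him)

/-- **`K_T ≠ ℚ`** when a factor has complex multiplication. [cite: ElsenhansJahnel2014, Rem. 3.5 (i)] [cite: Huybrechts2016K3, Ch. 3 Cor. 3.6] -/
theorem endAlg_transcendentalPart_ne_bot_of_quadratic_left
    (hT : (hodgeStructure (prodPeriod (ellipticPeriod hτ) (ellipticPeriod hτ')) 2).IsTranscendentalPart T) {p q : ℚ}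
    (hquad : τ ^ 2 + p * τ + q = 0) : T.toHodgeStructure.endAlg ≠ ⊥ := by
  obtain ⟨B, F, hF, him⟩ := exists_det_im_ne_zero_of_quadratic_left hτ hτ' hquad
  exact (isAbelianVariety_ellipticProd hτ hτ').endAlg_transcendentalPart_ne_bot_of_forall_det_ne (finSumFinEquiv (m := 2) (n := 2)).symm hT hF
    (forall_ne_ratCast_of_im_ne_zero him)

/-- **… and `ρ(E_τ × E_τ') ∈ {2, 4}`** (a product with a CM factor has even Picard number: `2` if the curves are not isogenous, `4` if they
are). [cite: ElsenhansJahnel2014, Rem. 3.5 (i)] [cite: Lange2023AbelianVarietiesComplex, §2.6 Exercises (2)–(3)] -/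
theorem finrank_hodgeClasses_eq_two_or_eq_four_of_quadratic_left {p q : ℚ} (hquad : τ ^ 2 + p * τ + q = 0)
    (hT : (hodgeStructure (prodPeriod (ellipticPeriod hτ) (ellipticPeriod hτ')) 2).IsTranscendentalPart T) :
    finrank ℚ (hodgeClasses (prodPeriod (ellipticPeriod hτ) (ellipticPeriod hτ')) 1) = 2 ∨
      finrank ℚ (hodgeClasses (prodPeriod (ellipticPeriod hτ) (ellipticPeriod hτ')) 1) = 4 := by
  obtain ⟨B, F, hF, him⟩ := exists_det_im_ne_zero_of_quadratic_left hτ hτ' hquad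
  exact (isAbelianVariety_ellipticProd hτ hτ').finrank_hodgeClasses_eq_two_or_eq_four_of_det_im_ne_zero (finSumFinEquiv (m := 2) (n := 2)).symm hT hF him

/-! ## §4 Two CM factors: non-isogenous ⟹ `[K_T : ℚ] = 4 = dim T(X)_ℚ` and `Hdg(T)(ℚ)` commutative; isogenous (`ρ = 4`) ⟹ `ε(K_T) = ℚ(τ)` -/

/-- **Four `ℚ`-linearly independent complex numbers in the image of `ε : K → ℂ` force `dim_ℚ K ≥ 4`** (`K` a finite-dimensional
`ℚ`-algebra). [cite: Huybrechts2016K3, Ch. 3 Cor. 3.6 and eq. (3.2)] -/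
theorem four_le_finrank_of_linearIndependent {K : Type*} [Ring K] [Algebra ℚ K] [Module.Finite ℚ K] (ε : K →ₐ[ℚ] ℂ) {a b c d : ℂ}
    (hv : LinearIndependent ℚ ![a, b, c, d]) (ha : a ∈ Set.range ε) (hb : b ∈ Set.range ε) (hc : c ∈ Set.range ε)
    (hd : d ∈ Set.range ε) : 4 ≤ finrank ℚ K := by
  have hle : Submodule.span ℚ (Set.range ![a, b, c, d]) ≤ LinearMap.range ε.toLinearMap := by
    rw [Submodule.span_le]
    rintro z ⟨i, rfl⟩
    fin_cases i
    · simpa [LinearMap.mem_range] using ha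
    · simpa [LinearMap.mem_range] using hb
    · simpa [LinearMap.mem_range] using hc
    · simpa [LinearMap.mem_range] using hd
  have hmono := Submodule.finrank_mono hle
  rw [finrank_span_eq_card hv, Fintype.card_fin] at hmono
  exact hmono.trans (LinearMap.finrank_range_le ε.toLinearMap)

/-- **If `dim_ℚ K = 2`, `ε : K ↪ ℂ`, and `b ∈ ε(K)` with `1, b` linearly independent, then `ε(K) = ℚ + ℚb`.**
[cite: Huybrechts2016K3, Ch. 3 Cor. 3.6 and Rem. 3.14 (iii)] -/
theorem range_eq_span_pair_of_finrank_eq_two {K : Type*} [Ring K] [Algebra ℚ K] [Module.Finite ℚ K] (ε : K →ₐ[ℚ] ℂ)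
    (hinj : Function.Injective ε) (h2 : finrank ℚ K = 2) {b : ℂ} (hli : LinearIndependent ℚ ![(1 : ℂ), b]) (hb : b ∈ Set.range ε) :
    Set.range ε = Submodule.span ℚ (Set.range ![(1 : ℂ), b]) := by
  have hle : Submodule.span ℚ (Set.range ![(1 : ℂ), b]) ≤ LinearMap.range ε.toLinearMap := by
    rw [Submodule.span_le]
    rintro z ⟨i, rfl⟩
    fin_cases i
    · exact ⟨1, map_one ε⟩
    · simpa [LinearMap.mem_range] using hb
  have hfin : finrank ℚ (Submodule.span ℚ (Set.range ![(1 : ℂ), b])) = finrank ℚ (LinearMap.range ε.toLinearMap) := by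
    rw [finrank_span_eq_card hli, Fintype.card_fin, LinearMap.finrank_range_of_inj hinj, h2]
  have heq := Submodule.eq_of_le_of_finrank_eq hle hfin
  ext z
  simp only [SetLike.mem_coe, heq, LinearMap.mem_range, Set.mem_range, AlgHom.toLinearMap_apply]

/-- **Two CM factors, not isogenous (`1, τ, τ', ττ'` linearly independent over `ℚ`): `[K_T : ℚ] ≥ 4`** — `ε(K_T) ∋ 1, τ, τ', ττ'`.
[cite: ElsenhansJahnel2014, Rem. 3.5 (i)] [cite: Huybrechts2016K3, Ch. 3 Cor. 3.6 and eq. (3.2)] -/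
theorem four_le_finrank_endAlg_transcendentalPart_of_quadratic_of_linearIndependent
    (hT : (hodgeStructure (prodPeriod (ellipticPeriod hτ) (ellipticPeriod hτ')) 2).IsTranscendentalPart T) {p q p' q' : ℚ}
    (hquad : τ ^ 2 + p * τ + q = 0) (hquad' : τ' ^ 2 + p' * τ' + q' = 0) (hli : LinearIndependent ℚ ![(1 : ℂ), τ, τ', τ * τ']) :
    4 ≤ finrank ℚ T.toHodgeStructure.endAlg :=
  haveI : Module.Finite ℚ T.toHodgeStructure.endAlg := finiteDimensional_endAlg T.toHodgeStructure
  ((isAbelianVariety_ellipticProd hτ hτ').exists_algHom_complex_injective (finSumFinEquiv (m := 2) (n := 2)).symm hT).elim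
    fun ε hε =>
      have h2 := mem_range_eps_of_quadratic_left hτ hτ' hT hε.2 hquad
      have h3 := mem_range_eps_of_quadratic_right hτ hτ' hT hε.2 hquad'
      four_le_finrank_of_linearIndependent ε hli ⟨1, map_one ε⟩ h2 h3 (mul_mem_range_algHom ε h2 h3)

/-- **Two non-isogenous CM factors: `[K_T : ℚ] = 4 = dim_ℚ T(X)_ℚ`** (`[K_T : ℚ] ∣ dim_ℚ T(X)_ℚ = 6 − ρ(X) = 4`, and `≥ 4`): `K_T ≅ ε(K_T) ⊇ ℚ(τ, τ')`
is a quartic CM field and `dim_{K_T} T(X)_ℚ = 1`. [cite: ElsenhansJahnel2014, Rem. 3.5 (i)] [cite: Huybrechts2016K3, Ch. 3 eq. (3.2) and Rem. 3.10]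
[cite: Lange2023AbelianVarietiesComplex, §2.6 Exercise (3)] -/
theorem finrank_endAlg_transcendentalPart_eq_four
    (hT : (hodgeStructure (prodPeriod (ellipticPeriod hτ) (ellipticPeriod hτ')) 2).IsTranscendentalPart T) {p q p' q' : ℚ}
    (hquad : τ ^ 2 + p * τ + q = 0) (hquad' : τ' ^ 2 + p' * τ' + q' = 0) (hli : LinearIndependent ℚ ![(1 : ℂ), τ, τ', τ * τ']) :
    finrank ℚ T.toHodgeStructure.endAlg = 4 ∧ finrank ℚ T.toSubmodule = 4 := by
  have h4 := four_le_finrank_endAlg_transcendentalPart_of_quadratic_of_linearIndependent hτ hτ' hT hquad hquad' hli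
  have hρ : finrank ℚ (hodgeClasses (prodPeriod (ellipticPeriod hτ) (ellipticPeriod hτ')) 1) = 2 :=
    (finrank_hodgeClasses_ellipticPair_eq_two_iff hτ hτ').2 hli
  have hdvd := (isAbelianVariety_ellipticProd hτ hτ').finrank_endAlg_transcendentalPart_dvd (finSumFinEquiv (m := 2) (n := 2)).symm hT
  have hT4 : finrank ℚ T.toSubmodule = 4 := by
    rw [finrank_transcendentalPart_eq _ (finSumFinEquiv (m := 2) (n := 2)).symm hT, hρ]
  rw [hρ] at hdvd
  have hle := Nat.le_of_dvd (by norm_num) hdvd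
  exact ⟨by omega, hT4⟩

/-- **Two non-isogenous CM factors: `Hdg(T(E_τ × E_τ')_ℚ)(ℚ)` is commutative** (Rem. 3.10: `dim_{K_T} T = 1`).
[cite: Huybrechts2016K3, Ch. 3 Rem. 3.10] [cite: ElsenhansJahnel2014, Rem. 3.5 (i)] [cite: Zarhin1983HodgeGroupsK3, Rem. 1.5.3] -/
theorem hodgeGroup_transcendentalPart_comm_of_quadratic_of_linearIndependent [HodgeTensorFacts.{0, 0}]
    (hT : (hodgeStructure (prodPeriod (ellipticPeriod hτ) (ellipticPeriod hτ')) 2).IsTranscendentalPart T) {p q p' q' : ℚ}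
    (hquad : τ ^ 2 + p * τ + q = 0) (hquad' : τ' ^ 2 + p' * τ' + q' = 0) (hli : LinearIndependent ℚ ![(1 : ℂ), τ, τ', τ * τ']) :
    ∀ g ∈ T.toHodgeStructure.hodgeGroup, ∀ g' ∈ T.toHodgeStructure.hodgeGroup, g * g' = g' * g :=
  have h := finrank_endAlg_transcendentalPart_eq_four hτ hτ' hT hquad hquad' hli
  ((isAbelianVariety_ellipticProd hτ hτ').hodgeGroup_transcendentalPart_comm_iff_finrank_endAlg_eq
    (finSumFinEquiv (m := 2) (n := 2)).symm hT).2 (h.1.trans h.2.symm)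

/-- **Two CM factors with `ρ(E_τ × E_τ') = 4` (isogenous): `ε(K_T) = ℚ + ℚτ = ℚ(τ)`** — the endomorphism field of `T(X)_ℚ` is the common
imaginary quadratic field of the factors (`[K_T : ℚ] = 2`, g28-#1, and `ℚ(τ) ⊆ ε(K_T)`). [cite: ElsenhansJahnel2014, Rem. 3.5 (i)]
[cite: Huybrechts2016K3, Ch. 3 Rem. 3.14 (iii) and Cor. 3.6] -/
theorem range_eps_eq_span_of_eq_four
    (hT : (hodgeStructure (prodPeriod (ellipticPeriod hτ) (ellipticPeriod hτ')) 2).IsTranscendentalPart T) {p q : ℚ}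
    (hquad : τ ^ 2 + p * τ + q = 0) (h4 : finrank ℚ (hodgeClasses (prodPeriod (ellipticPeriod hτ) (ellipticPeriod hτ')) 1) = 4)
    {ε : T.toHodgeStructure.endAlg →ₐ[ℚ] ℂ} (hinj : Function.Injective ε)
    (hε : ∀ (b : T.toHodgeStructure.endAlg) (z : ℂ ⊗[ℚ] T.toSubmodule), z ∈ T.toHodgeStructure.piece 2 0 →
      (b : Module.End ℚ T.toSubmodule).baseChange ℂ z = ε b • z) :
    Set.range ε = Submodule.span ℚ (Set.range ![(1 : ℂ), τ]) :=
  haveI : Module.Finite ℚ T.toHodgeStructure.endAlg := finiteDimensional_endAlg T.toHodgeStructure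
  range_eq_span_pair_of_finrank_eq_two ε hinj
    ((isAbelianVariety_ellipticProd hτ hτ').finrank_endAlg_transcendentalPart_eq_two_of_eq_four (finSumFinEquiv (m := 2) (n := 2)).symm hT h4)
    (linearIndependent_one_tau hτ) (mem_range_eps_of_quadratic_left hτ hτ' hT hε hquad)

end Elliptic

end ComplexTorus

end Literature.Geometry.Kaehler

end
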